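import Summits.BirchSwinnertonDyer.BirchSwinnertonDyer.Theorems.SylvesterTwoHeegnerIndexUpperOffV0FourTorsionRows
import HarnessLib

/-!
# K7t crux `UpperOffV0HSYPlus` (item 19804): ORDER from EXPONENT and 2-RANK — the re-cut of the
# off-𝒱₀ upper half into (U1) sharp exponent + (U2) `#Ш(E_p)[2] ≤ 4`

Route `SylvesterTwoHeegnerIndex` (cell bsd-cm, rung K7t), line `offv0-kolyvagin2`, k7t-c2 g7 (memo
K7T-UPPER-ISOTROPY §3).  The crux's off-𝒱₀ clause is an ORDER statement (`MissingUpperBoundAt B 2 ⟺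
ord₂ #Ш(E_p) ≤ ord₂ #Ш_an(E_p)`, k7t-c3's `SylvesterTwoLowerCert.missingUpperBoundAt_iff_not_pow_succ_dvd`),
while Kolyvagin's descent at `2` (stubs (d)+(e), `…UpperOffV0DescentDefect`) yields EXPONENT bounds and —
by ISOTROPY (`…UpperOffV0LevelOneIsotropy`) — never bounds the number of cyclic factors of `Ш[2^∞]`.
This file is the elementary bridge that makes the re-cut precise:

* `card_le_pow_of_card_torsion_le_of_exponent` — for a finite abelian group `G`, a prime `p`, and
  `r, e` with `#G[p] ≤ p^r` and `p^e G = 0`: **`#G ≤ p^{re}`** (induction on `e` through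
  `0 → G[p] → G → pG → 0`; no structure theorem);
* `padicValNat_two_card_le_of_twoRank_of_exponent` — `#G[2] ≤ 4` and `2^e · G[2^∞] = 0` give
  `ord₂ #G ≤ 2e`;
* **`missingUpperBoundAt_two_of_twoRank_of_exponent`** — on 𝒞_HSY, granted the published facts of
  the route (HSY Thm 1.4, CM rank-`0` BSD, modularity, as in k7t-c3's file): (U2) `#Ш(E_p)[2] ≤ 4`
  and (U1) `2^e · Ш(E_p)[2^∞] = 0` with `2e ≤ n = ord₂ #Ш_an(E_p)` imply `MissingUpperBoundAt E_p 2`.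

So the off-𝒱₀ UPPER half follows from a SHARP EXPONENT bound (`e = n/2`: «`√#Ш_an` kills `Ш[2^∞]`»,
Euler-system content) together with a 2-RANK bound (`dim_𝔽₂ Ш(E_p)[2] ≤ 2`, 2-descent content; true on
all `7493` census members `p ≤ 4·10⁵`, NOT a theorem for the class).  Both inputs are displayed
hypotheses; nothing is claimed about them.  HONEST FRAMING: bookkeeping bridge; closes no item; B14 =
O12 open as a class; BSD not claimed; no definition, no named fact, no sorry.
-/

noncomputable section

open scoped Classical
open WeierstrassCurve NumberField Literature.NumberTheory.EllipticCurves
  Literature.NumberTheory.EllipticCurves.HuShuYin2019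
  Literature.NumberTheory.EllipticCurves.Rank1Residual.Typed

set_option autoImplicit false
set_option linter.dupNamespace false

namespace Summit.BirchSwinnertonDyer.BirchSwinnertonDyer.Theorems.SylvesterTwoUpper.TwoRank

universe u

/-! ## §1 Finite abelian groups: order ≤ (rank bound) × (exponent bound) -/

/-- **`#G ≤ p^{re}` from `#G[p] ≤ p^r` and `p^e G = 0`** for a finite abelian group `G` and a prime
`p`.  Induction on `e`: multiplication by `p` has kernel `G[p]` (order `≤ p^r`) and image `pG`, which
is killed by `p^{e-1}` and has `(pG)[p] ⊆ G[p]`. [folklore] -/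
theorem card_le_pow_of_card_torsion_le_of_exponent (p : ℕ) (r : ℕ) :
    ∀ (e : ℕ) (G : Type u) [AddCommGroup G] [Finite G],
      Nat.card {g : G // (p : ℤ) • g = 0} ≤ p ^ r → (∀ g : G, ((p : ℤ) ^ e) • g = 0) →
      Nat.card G ≤ p ^ (r * e) := by
  intro e
  induction e with
  | zero =>
    intro G _ _ _ he
    haveI : Subsingleton G := ⟨fun a b ↦ by
      have ha := he a
      have hb := he b
      rw [pow_zero, one_zsmul] at ha hb
      rw [ha, hb]⟩
    rw [mul_zero, pow_zero, Nat.card_unique (α := G)]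
  | succ e ih =>
    intro G _ _ hr he
    -- multiplication by `p`
    let f : G →+ G := DistribSMul.toAddMonoidHom G (p : ℤ)
    have hf : ∀ g : G, f g = (p : ℤ) • g := fun g ↦ rfl
    -- `#G = #ker · #range`
    have hcard : Nat.card G = Nat.card f.ker * Nat.card f.range := by
      rw [AddSubgroup.card_eq_card_quotient_mul_card_addSubgroup f.ker, mul_comm,
        Nat.card_congr (QuotientAddGroup.quotientKerEquivRange f).toEquiv]
    -- the kernel is `G[p]`
    have hker : Nat.card f.ker ≤ p ^ r := by
      have e1 : Nat.card f.ker = Nat.card {g : G // (p : ℤ) • g = 0} :=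
        Nat.card_congr (Equiv.subtypeEquivRight fun g ↦ by rw [AddMonoidHom.mem_ker, hf])
      rw [e1]; exact hr
    -- the image is killed by `p^e` and its `p`-torsion injects into `G[p]`
    have hrange_exp : ∀ y : f.range, ((p : ℤ) ^ e) • y = 0 := by
      rintro ⟨y, g, rfl⟩
      apply Subtype.ext
      change ((p : ℤ) ^ e) • f g = 0
      rw [hf, smul_smul, ← pow_succ, he g]
    have hrange_tor : Nat.card {y : f.range // (p : ℤ) • y = 0} ≤ p ^ r := by
      refine le_trans ?_ hr
      refine Nat.card_le_card_of_injective
        (fun y ↦ ⟨(y.1 : G), by rw [← AddSubgroupClass.coe_zsmul, y.2, ZeroMemClass.coe_zero]⟩) ?_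
      intro a b hab
      have h1 : ((a.1 : f.range) : G) = ((b.1 : f.range) : G) := by
        simpa using congrArg Subtype.val hab
      exact Subtype.ext (Subtype.ext h1)
    have hrange : Nat.card f.range ≤ p ^ (r * e) := ih f.range hrange_tor hrange_exp
    rw [hcard, Nat.mul_succ, pow_add, mul_comm (p ^ (r * e))]
    exact Nat.mul_le_mul hker hrange

/-- **`ord₂ #G ≤ 2e` from `#G[2] ≤ 4` and `2^e · G[2^∞] = 0`** for a finite abelian group `G`
(apply `card_le_pow_of_card_torsion_le_of_exponent` to the `2`-primary component, whose order is
`2^{ord₂ #G}`).  DICTIONARY: `G = Ш(E_p/ℚ)`; `#G[2] ≤ 4` = (U2), the 2-RANK input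
(`dim_𝔽₂ Ш(E_p)[2] ≤ 2`; 2-descent); `2^e·G[2^∞] = 0` = (U1), an EXPONENT bound (Euler-system
content: `…UpperOffV0DescentDefect` gives one with defect). [folklore] -/
theorem padicValNat_two_card_le_of_twoRank_of_exponent {G : Type u} [AddCommGroup G] [Finite G]
    (h4 : Nat.card {g : G // (2 : ℤ) • g = 0} ≤ 4) {e : ℕ}
    (he : ∀ g : G, g ∈ AddCommGroup.primaryComponent G 2 → ((2 : ℤ) ^ e) • g = 0) :
    padicValNat 2 (Nat.card G) ≤ 2 * e := by
  haveI : Fact (Nat.Prime 2) := ⟨Nat.prime_two⟩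
  set P := AddCommGroup.primaryComponent G 2 with hP
  -- the `2`-torsion of `P` injects into that of `G`
  have hP4 : Nat.card {x : P // ((2 : ℕ) : ℤ) • x = 0} ≤ 2 ^ 2 := by
    refine le_trans (Nat.card_le_card_of_injective
      (fun x ↦ (⟨(x.1 : G), by
        rw [← Nat.cast_ofNat, ← AddSubgroupClass.coe_zsmul, x.2, ZeroMemClass.coe_zero]⟩ :
        {g : G // (2 : ℤ) • g = 0})) ?_) (by simpa using h4)
    intro a b hab
    have h1 : ((a.1 : P) : G) = ((b.1 : P) : G) := by
      simpa using congrArg Subtype.val hab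
    exact Subtype.ext (Subtype.ext h1)
  have hPe : ∀ x : P, (((2 : ℕ) : ℤ) ^ e) • x = 0 := fun x ↦ by
    apply Subtype.ext
    have := he x.1 x.2
    simpa using this
  have hcardP : Nat.card P ≤ 2 ^ (2 * e) :=
    card_le_pow_of_card_torsion_le_of_exponent 2 2 e P hP4 hPe
  -- `#P = 2^{ord₂ #G}`
  have hpow : Nat.card P = 2 ^ padicValNat 2 (Nat.card G) := by
    rw [hP, card_addPrimaryComponent_eq_pow, ← Nat.factorization_def _ Nat.prime_two]
  rw [hpow] at hcardP
  exact (Nat.pow_le_pow_iff_right (by norm_num)).mp hcardP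

/-! ## §2 The off-𝒱₀ UPPER half on 𝒞_HSY from (U1) + (U2) -/

/-- **UPPER at `2` on 𝒞_HSY from a 2-RANK bound and a SHARP EXPONENT bound.**  For a globally
minimal model `W` of `E_p` (`p ≡ 4, 7 (mod 9)`, `3 ∉ 𝔽_p^{×3}`), granted HSY Thm 1.4, CM rank-`0` BSD
and modularity (the inputs of k7t-c3's `missingUpperBoundAt_iff_not_pow_succ_dvd`), with
`#Ш_an(W) = q`, `ord₂ q = n`: if (U2) `#Ш(W)[2] ≤ 4` and (U1) `2^e · Ш(W)[2^∞] = 0` for some `e` with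
`2e ≤ n`, then `MissingUpperBoundAt W 2` (the Euler-system half `ord₂ #Ш ≤ ord₂ #Ш_an`).  With
`e = n/2` this reads: «`√#Ш_an(E_p)` kills `Ш(E_p)[2^∞]`» + «`dim Ш(E_p)[2] ≤ 2`» ⟹ UPPER — the
re-cut of stub (f)+(g) of line `offv0-kolyvagin2` (memo K7T-UPPER-ISOTROPY §3): (U1) is what
Heegner-class duality can address (exponent), (U2) is what it cannot (ISOTROPY) and 2-descent can.
[cite: HuShuYin2019, Thm. 1.4] [cite: GrossLMS1991, §10] -/
theorem missingUpperBoundAt_two_of_twoRank_of_exponent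
    (W : WeierstrassCurve ℚ) [W.IsElliptic] [W.IsGloballyMinimal]
    (hHSY : thm14_threePart_product) (hBF : bsdTriple_of_hasCM_of_L_one_ne_zero)
    (hmod : hasEntireLFunction_rat)
    {p : ℕ} (hp : p.Prime) (h9 : p % 9 = 4 ∨ p % 9 = 7) (h3 : ¬ ∃ x : ZMod p, x ^ 3 = 3)
    (hW : ∃ C : VariableChange ℚ, C • W = cubeSumCurve (p : ℚ))
    {q : ℚ} (hq : shaAn W = (q : ℂ)) {n : ℕ} (hv : padicValRat 2 q = n)
    (h4 : Nat.card {g : W.sha // (2 : ℤ) • g = 0} ≤ 4) {e : ℕ}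
    (he : ∀ g : W.sha, g ∈ AddCommGroup.primaryComponent W.sha 2 → ((2 : ℤ) ^ e) • g = 0)
    (hen : 2 * e ≤ n) :
    MissingUpperBoundAt W 2 := by
  haveI : Fact (Nat.Prime 2) := ⟨Nat.prime_two⟩
  obtain ⟨-, hfin, -⟩ :=
    Summit.BirchSwinnertonDyer.Rank1Residual.X12.CubeSumFamilies.bsdp_three_of_thm14' hHSY hBF hmod
      hp h9 h3 W hW
  haveI := hfin
  rw [SylvesterTwoLowerCert.missingUpperBoundAt_iff_not_pow_succ_dvd W hHSY hBF hmod hp h9 h3 hW hq hv]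
  intro hdvd
  have hcard : Nat.card W.sha ≠ 0 := (Nat.card_pos (α := W.sha)).ne'
  have hle : padicValNat 2 (Nat.card W.sha) ≤ 2 * e :=
    padicValNat_two_card_le_of_twoRank_of_exponent h4 he
  have hge : n + 1 ≤ padicValNat 2 (Nat.card W.sha) :=
    (padicValNat_dvd_iff_le hcard).mp hdvd
  omega

end Summit.BirchSwinnertonDyer.BirchSwinnertonDyer.Theorems.SylvesterTwoUpper.TwoRank

end
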